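import Mathlib
import Summits.CriticalPhenomena.CardyFormulaZ2.Theorems.CardySelfRefinementGradientComparabilityStubNonAxialShareBulkFrames
import HarnessLib

/-!
# Local surgery around a pivotal axial edge: the leaf case, level 2

Helper file for the stub `stub_nonAxialShare_bulk` (D4-bulk) of the line `Sketch` (crux
`stmt-CriticalPhenomena-10269`, `…Theses.CardySelfRefinement.GradientComparability`), continuing
`…BulkFrames.lean` (frame `V a b = p + a • u + b • w` around the pivotal axial edge
`e = {V 0 0, V 1 0}`).

* `leaf_facts`: if both cells beside `e` fail (the corners `V 0 (±1)` above/below `p = V 0 0` are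
  linked to the side `∂_{jq}Q` of `q`), then both perpendicular edges at `p` are closed, `p` is a
  leaf of `σ` hanging on `c = V (-1) 0` through the open feeding edge, and `c` is linked to
  `∂_{jp}Q` only;
* **level 2** (`level2`, registered sub-goal; packaging `out_level2`): closing `e` and the feeding
  edge and opening the detour `c → c' → p' → p → q` on side `t` makes the rail `{c', p'}` or the
  post `{c, c'}` pivotal, unless the post is not admissible and `c'` is linked to `∂_{jq}Q`;
* `out_level3`: packaging of the level-3 detour `cc → cc' → c' → c → p → q` (used in
  `…BulkDrivers.lean`).

No percolation, no named fact.
-/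

noncomputable section

namespace Summit.CriticalPhenomena.CardyFormulaZ2.Theorems.CardySelfRefinement

open scoped Topology
open Filter Set MeasureTheory Metric
open Literature.Probability.LatticeModels Literature.Probability.Percolation
open Literature.Probability.Percolation.QuadCrossing
open Summit.CriticalPhenomena.CardyFormulaZ2.Theses.CardySelfRefinement

variable {D : Set ℂ} {δ : ℝ}

/-! ## The local surgery: the leaf case (levels 2 and 3) -/

/-- **Leaf facts.**  If both cells beside `e` fail through `V 0 (±1)` being linked to
`∂_{jq}Q`, then the two perpendicular edges at `V 0 0` are closed, `V 0 0` is a leaf of `σ`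
hanging on `c = V (-1) 0` through the open feeding edge `{V 0 0, V (-1) 0}`, and `c` is linked to
`∂_{jp}Q` only. -/
theorem leaf_facts (hδ : 0 < δ) (Q : Quad D) {σ : BondConfig (Site 2)} {jp jq : Fin 4}
    (hj : (jp = 0 ∧ jq = 2) ∨ (jp = 2 ∧ jq = 0))
    (hσ : ¬ ∃ a ∈ Q.side 0, ∃ b ∈ Q.side 2, JoinedIn (Q.carrier ∩ openEdgeUnion δ σ) a b)
    {V : ℤ → ℤ → Site 2} {p u w : Site 2} (hV : ∀ a b, V a b = p + a • u + b • w)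
    (hfr : ((u = ![1, 0] ∨ u = ![-1, 0]) ∧ (w = ![0, 1] ∨ w = ![0, -1])) ∨
      ((u = ![0, 1] ∨ u = ![0, -1]) ∧ (w = ![1, 0] ∨ w = ![-1, 0])))
    (hball : Metric.closedBall (meshPoint δ p) (4 * δ) ⊆ interior Q.carrier)
    (he : s(V 0 0, V 1 0) ∉ σ)
    (hpL : ∃ a ∈ Q.side jp, JoinedIn (Q.carrier ∩ openEdgeUnion δ σ) a (meshPoint δ (V 0 0))) (hpR : ¬ ∃ a ∈ Q.side jq, JoinedIn (Q.carrier ∩ openEdgeUnion δ σ) a (meshPoint δ (V 0 0))) (hup : ∃ a ∈ Q.side jq, JoinedIn (Q.carrier ∩ openEdgeUnion δ σ) a (meshPoint δ (V 0 1))) (hdn : ∃ a ∈ Q.side jq, JoinedIn (Q.carrier ∩ openEdgeUnion δ σ) a (meshPoint δ (V 0 (-1)))) :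
    s(V 0 0, V (-1) 0) ∈ σ ∧ (∀ y, (zdGraph 2).Adj (V 0 0) y → s(V 0 0, y) ∈ σ → y = V (-1) 0) ∧
      (∃ a ∈ Q.side jp, JoinedIn (Q.carrier ∩ openEdgeUnion δ σ) a (meshPoint δ (V (-1) 0))) ∧ ¬ ∃ a ∈ Q.side jq, JoinedIn (Q.carrier ∩ openEdgeUnion δ σ) a (meshPoint δ (V (-1) 0)) := by
  have hI : ∀ a b a' b' : ℤ, |(a : ℝ)| + |(b : ℝ)| ≤ 4 → |(a' : ℝ)| + |(b' : ℝ)| ≤ 4 →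
      segment ℝ (meshPoint δ (V a b)) (meshPoint δ (V a' b')) ⊆ Q.carrier :=
    fun a b a' b' h h' => (frame_segment_subset_interior hδ Q hV hfr hball h h').trans interior_subset
  have hclosed : ∀ t : ℤ, t = 1 ∨ t = -1 → (∃ a ∈ Q.side jq, JoinedIn (Q.carrier ∩ openEdgeUnion δ σ) a (meshPoint δ (V 0 t))) → s(V 0 0, V 0 t) ∉ σ := by
    intro t ht hlk hmem
    have hadj : (zdGraph 2).Adj (V 0 0) (V 0 t) := frame_adj hV hfr (by rcases ht with rfl | rfl <;> norm_num)
    have hJ := joinedIn_of_adj_mem δ Q hadj hmem (hI 0 0 0 t (by norm_num)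
      (by rcases ht with rfl | rfl <;> norm_num))
    exact hpR (link_of_joinedIn hlk hJ.symm)
  have hleaf : ∀ y, (zdGraph 2).Adj (V 0 0) y → s(V 0 0, y) ∈ σ → y = V (-1) 0 := by
    intro y hy hmem
    rcases frame_neighbours hV hfr hy with rfl | rfl | rfl | rfl
    · exact absurd hmem (by norm_num; exact he)
    · norm_num
    · exact absurd hmem (by norm_num; exact hclosed 1 (Or.inl rfl) hup)
    · exact absurd hmem (by norm_num; exact hclosed (-1) (Or.inr rfl) hdn)
  have hfeed : s(V 0 0, V (-1) 0) ∈ σ := by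
    obtain ⟨y, hy, hmem⟩ := exists_adj_mem_of_meshPoint_mem hδ hpL.choose_spec.2.mem.2.2
    rwa [hleaf y hy hmem] at hmem
  have hadj : (zdGraph 2).Adj (V 0 0) (V (-1) 0) := frame_adj hV hfr (Or.inr (Or.inl ⟨by norm_num, rfl⟩))
  have hcL : ∃ a ∈ Q.side jp, JoinedIn (Q.carrier ∩ openEdgeUnion δ σ) a (meshPoint δ (V (-1) 0)) :=
    link_of_joinedIn hpL (joinedIn_of_adj_mem δ Q hadj hfeed (hI 0 0 (-1) 0 (by norm_num) (by norm_num)))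
  exact ⟨hfeed, hleaf, hcL, fun h => hσ (crossing_of_two_links Q hj hcL h)⟩

/-- Output packaging for level 2: the detour `c → c' → p' → p → q` (`c = V (-1) 0`, side `t`). -/
theorem out_level2 (δ : ℝ) (Q : Quad D) {σ : BondConfig (Site 2)}
    {V : ℤ → ℤ → Site 2} {p u w : Site 2} (hV : ∀ a b, V a b = p + a • u + b • w)
    (hfr : ((u = ![1, 0] ∨ u = ![-1, 0]) ∧ (w = ![0, 1] ∨ w = ![0, -1])) ∨
      ((u = ![0, 1] ∨ u = ![0, -1]) ∧ (w = ![1, 0] ∨ w = ![-1, 0])))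
    {t : ℤ} (ht : t = 1 ∨ t = -1) {Adm : Sym2 (Site 2) → Prop} {e' : Sym2 (Site 2)}
    (he' : e' ∈ ({s(V (-1) 0, V (-1) t), s(V (-1) t, V 0 t), s(V 0 t, V 0 0), s(V 0 0, V 1 0)} : Set _))
    (hA : Adm e')
    (hnc : ¬ ∃ a ∈ Q.side 0, ∃ b ∈ Q.side 2, JoinedIn (Q.carrier ∩ openEdgeUnion δ
      (σ \ {s(V 0 0, V 1 0), s(V (-1) 0, V 0 0)} ∪
        (({s(V (-1) 0, V (-1) t), s(V (-1) t, V 0 t), s(V 0 t, V 0 0), s(V 0 0, V 1 0)} : Set _) \ {e'}))) a b) :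
    ∃ (Rm S : Set (Sym2 (Site 2))) (e' : Sym2 (Site 2)), s(V 0 0, V 1 0) ∈ Rm ∧ e' ∈ S ∧ Adm e' ∧
      (∀ r ∈ Rm ∪ S, ∃ x y, r = s(x, y) ∧ (zdGraph 2).Adj x y ∧
        ∀ i, |x i - p i| ≤ 3 ∧ |y i - p i| ≤ 3) ∧
      IsPreconnected (openEdgeUnion δ S) ∧ (∀ r ∈ Rm, ∀ x ∈ r, meshPoint δ x ∈ openEdgeUnion δ S) ∧
      ¬ ∃ a ∈ Q.side 0, ∃ b ∈ Q.side 2,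
        JoinedIn (Q.carrier ∩ openEdgeUnion δ (σ \ Rm ∪ (S \ {e'}))) a b := by
  have ht1 : |t| ≤ 1 := by rcases ht with rfl | rfl <;> norm_num
  have h1 : (zdGraph 2).Adj (V (-1) 0) (V (-1) t) :=
    frame_adj hV hfr (by rcases ht with rfl | rfl <;> norm_num)
  have h2 : (zdGraph 2).Adj (V (-1) t) (V 0 t) := frame_adj hV hfr (Or.inl ⟨by norm_num, rfl⟩)
  have h3 : (zdGraph 2).Adj (V 0 t) (V 0 0) :=
    frame_adj hV hfr (by rcases ht with rfl | rfl <;> norm_num)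
  have h4 : (zdGraph 2).Adj (V 0 0) (V 1 0) := frame_adj hV hfr (Or.inl ⟨by norm_num, rfl⟩)
  refine ⟨{s(V 0 0, V 1 0), s(V (-1) 0, V 0 0)},
    {s(V (-1) 0, V (-1) t), s(V (-1) t, V 0 t), s(V 0 t, V 0 0), s(V 0 0, V 1 0)}, e', Or.inl rfl, he',
    hA, ?_, ?_, ?_, hnc⟩
  · rintro r ((hr | hr) | hr | hr | hr | hr)
    · rw [hr]
      exact frame_edge_near hV hfr (Or.inl ⟨by norm_num, rfl⟩) (by norm_num) (by norm_num)
    · rw [Set.mem_singleton_iff.1 hr]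
      exact frame_edge_near hV hfr (Or.inl ⟨by norm_num, rfl⟩) (by norm_num) (by norm_num)
    · rw [hr]
      exact frame_edge_near hV hfr (by rcases ht with rfl | rfl <;> norm_num) (by norm_num)
        (by norm_num; omega)
    · rw [hr]
      exact frame_edge_near hV hfr (Or.inl ⟨by norm_num, rfl⟩) (by norm_num; omega)
        (by norm_num; omega)
    · rw [hr]
      exact frame_edge_near hV hfr (by rcases ht with rfl | rfl <;> norm_num)
        (by norm_num; omega) (by norm_num)
    · rw [Set.mem_singleton_iff.1 hr]
      exact frame_edge_near hV hfr (Or.inl ⟨by norm_num, rfl⟩) (by norm_num) (by norm_num)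
  · refine isPreconnected_openEdgeUnion_insert δ h1
      (meshPoint_mem_openEdgeUnion δ h2 (Or.inl rfl))
      (isPreconnected_openEdgeUnion_insert δ h2 (meshPoint_mem_openEdgeUnion δ h3 (Or.inl rfl))
        (isPreconnected_openEdgeUnion_insert δ h3 (meshPoint_mem_openEdgeUnion δ h4 rfl) ?_))
    rw [openEdgeUnion_singleton_eq δ h4]
    exact (convex_segment _ _).isPreconnected
  · have hp : meshPoint δ (V 0 0) ∈ openEdgeUnion δ
        ({s(V (-1) 0, V (-1) t), s(V (-1) t, V 0 t), s(V 0 t, V 0 0), s(V 0 0, V 1 0)} : Set _) :=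
      meshPoint_mem_openEdgeUnion δ h4 (Or.inr (Or.inr (Or.inr rfl)))
    rintro r (hr | hr) x hx
    · rw [hr] at hx
      rcases Sym2.mem_iff.1 hx with rfl | rfl
      · exact hp
      · refine meshPoint_mem_openEdgeUnion δ h4.symm (Or.inr (Or.inr (Or.inr ?_)))
        rw [Sym2.eq_swap]; rfl
    · rw [Set.mem_singleton_iff.1 hr] at hx
      rcases Sym2.mem_iff.1 hx with rfl | rfl
      · exact meshPoint_mem_openEdgeUnion δ h1 (Or.inl rfl)
      · exact hp

/-- **Level 2.**  Both cells beside `e` failed (`V 0 (±1)` linked to `∂_{jq}Q`), so `V 0 0` is a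
leaf on `c = V (-1) 0`.  On side `t`, with the candidate rail `ê_c = {V (-1) t, V 0 t}`
(admissible) and post `f_c = {V (-1) 0, V (-1) t}` (admissible, or else `V (-1) t` not linked
to `∂_{jq}Q`): closing `e` and the feeding edge and opening the detour `c → c' → p' → p → q`
makes an admissible edge pivotal. -/
theorem level2 {D : Set ℂ} {δ : ℝ} (hδ : 0 < δ) (Q : Quad D) {σ : BondConfig (Site 2)} {jp jq : Fin 4}
    (hj : (jp = 0 ∧ jq = 2) ∨ (jp = 2 ∧ jq = 0))
    (hσ : ¬ ∃ a ∈ Q.side 0, ∃ b ∈ Q.side 2, JoinedIn (Q.carrier ∩ openEdgeUnion δ σ) a b)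
    {V : ℤ → ℤ → Site 2} {p u w : Site 2} (hV : ∀ a b, V a b = p + a • u + b • w)
    (hfr : ((u = ![1, 0] ∨ u = ![-1, 0]) ∧ (w = ![0, 1] ∨ w = ![0, -1])) ∨
      ((u = ![0, 1] ∨ u = ![0, -1]) ∧ (w = ![1, 0] ∨ w = ![-1, 0])))
    (hball : Metric.closedBall (meshPoint δ p) (4 * δ) ⊆ interior Q.carrier)
    (he : s(V 0 0, V 1 0) ∉ σ)
    (hpL : ∃ a ∈ Q.side jp, JoinedIn (Q.carrier ∩ openEdgeUnion δ σ) a (meshPoint δ (V 0 0))) (hpR : ¬ ∃ a ∈ Q.side jq, JoinedIn (Q.carrier ∩ openEdgeUnion δ σ) a (meshPoint δ (V 0 0))) (hqR : ∃ a ∈ Q.side jq, JoinedIn (Q.carrier ∩ openEdgeUnion δ σ) a (meshPoint δ (V 1 0))) (hqL : ¬ ∃ a ∈ Q.side jp, JoinedIn (Q.carrier ∩ openEdgeUnion δ σ) a (meshPoint δ (V 1 0)))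
    (hup : ∃ a ∈ Q.side jq, JoinedIn (Q.carrier ∩ openEdgeUnion δ σ) a (meshPoint δ (V 0 1))) (hdn : ∃ a ∈ Q.side jq, JoinedIn (Q.carrier ∩ openEdgeUnion δ σ) a (meshPoint δ (V 0 (-1))))
    {t : ℤ} (ht : t = 1 ∨ t = -1) {Adm : Sym2 (Site 2) → Prop}
    (hAê : Adm s(V (-1) t, V 0 t)) (hAf : Adm s(V (-1) 0, V (-1) t) ∨ ¬ ∃ a ∈ Q.side jq, JoinedIn (Q.carrier ∩ openEdgeUnion δ σ) a (meshPoint δ (V (-1) t))) :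
    ∃ (Rm S : Set (Sym2 (Site 2))) (e' : Sym2 (Site 2)), s(V 0 0, V 1 0) ∈ Rm ∧ e' ∈ S ∧ Adm e' ∧
      (∀ r ∈ Rm ∪ S, ∃ x y, r = s(x, y) ∧ (zdGraph 2).Adj x y ∧
        ∀ i, |x i - p i| ≤ 3 ∧ |y i - p i| ≤ 3) ∧
      IsPreconnected (openEdgeUnion δ S) ∧ (∀ r ∈ Rm, ∀ x ∈ r, meshPoint δ x ∈ openEdgeUnion δ S) ∧
      ¬ ∃ a ∈ Q.side 0, ∃ b ∈ Q.side 2,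
        JoinedIn (Q.carrier ∩ openEdgeUnion δ (σ \ Rm ∪ (S \ {e'}))) a b := by
  obtain ⟨_, hleaf, hcL, hcR⟩ := leaf_facts hδ Q hj hσ hV hfr hball he hpL hpR hup hdn
  have ht1 : |(t : ℝ)| ≤ 1 := by rcases ht with rfl | rfl <;> norm_num
  have hI : ∀ a b a' b' : ℤ, |(a : ℝ)| + |(b : ℝ)| ≤ 4 → |(a' : ℝ)| + |(b' : ℝ)| ≤ 4 →
      segment ℝ (meshPoint δ (V a b)) (meshPoint δ (V a' b')) ⊆ interior Q.carrier :=
    fun a b a' b' h h' => frame_segment_subset_interior hδ Q hV hfr hball h h'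
  have h00 : |((0 : ℤ) : ℝ)| + |((0 : ℤ) : ℝ)| ≤ 4 := by norm_num
  have h10 : |((1 : ℤ) : ℝ)| + |((0 : ℤ) : ℝ)| ≤ 4 := by norm_num
  have hm0 : |((-1 : ℤ) : ℝ)| + |((0 : ℤ) : ℝ)| ≤ 4 := by norm_num
  have h0t : |((0 : ℤ) : ℝ)| + |(t : ℝ)| ≤ 4 := by norm_num; linarith
  have hmt : |((-1 : ℤ) : ℝ)| + |(t : ℝ)| ≤ 4 := by norm_num; linarith
  have hp't : ∃ a ∈ Q.side jq, JoinedIn (Q.carrier ∩ openEdgeUnion δ σ) a (meshPoint δ (V 0 t)) := by rcases ht with rfl | rfl; exacts [hup, hdn]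
  have hpc : (zdGraph 2).Adj (V 0 0) (V (-1) 0) := frame_adj hV hfr (Or.inr (Or.inl ⟨by norm_num, rfl⟩))
  by_cases h : ∃ a ∈ Q.side jq, JoinedIn (Q.carrier ∩ openEdgeUnion δ σ) a (meshPoint δ (V (-1) t))
  · -- the post `f_c` works
    have hA : Adm s(V (-1) 0, V (-1) t) := hAf.resolve_right (fun h' => h' h)
    have hc'L : ¬ ∃ a ∈ Q.side jp, JoinedIn (Q.carrier ∩ openEdgeUnion δ σ) a (meshPoint δ (V (-1) t)) := fun h' => hσ (crossing_of_two_links Q hj h' h)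
    have key := not_crossing_lev2_end hδ Q hj hσ (q := V 1 0) (c' := V (-1) t) (p' := V 0 t) hpc hleaf
      (openEdgeUnion_subset_of_forall fun x y _ hxy => by
        rcases hxy with h' | h' | h'
        · rw [segment_meshPoint_eq_of_sym2_eq δ h']; exact hI _ _ _ _ hmt h0t
        · rw [segment_meshPoint_eq_of_sym2_eq δ h']; exact hI _ _ _ _ h0t h00
        · rw [segment_meshPoint_eq_of_sym2_eq δ (Set.mem_singleton_iff.1 h')]; exact hI _ _ _ _ h00 h10)
      hqR hqL hp't hc'L
    refine out_level2 δ Q hV hfr ht (Or.inl rfl) hA fun ⟨a, ha, b, hb, hJ⟩ =>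
      key ⟨a, ha, b, hb, joinedIn_mono_config δ Q ?_ hJ⟩
    rintro x (hx | ⟨hx | hx | hx | hx, hne⟩)
    · exact Or.inl (Or.inl ⟨hx.1, fun h' => hx.2 (Or.inr h')⟩)
    · exact absurd hx hne
    · exact Or.inr (Or.inl hx)
    · exact Or.inr (Or.inr (Or.inl hx))
    · exact Or.inr (Or.inr (Or.inr hx))
  · -- the rail `ê_c` works
    have key := not_crossing_lev2_mid hδ Q hj hσ (q := V 1 0) (c' := V (-1) t) (p' := V 0 t) hpc
      (frame_adj hV hfr (by rcases ht with rfl | rfl <;> norm_num))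
      (frame_adj hV hfr (by rcases ht with rfl | rfl <;> norm_num))
      (frame_adj hV hfr (Or.inl ⟨by norm_num, rfl⟩))
      (frame_ne hV hfr (Or.inl (by norm_num))) (frame_ne hV hfr (Or.inl (by norm_num)))
      (frame_ne hV hfr (Or.inl (by norm_num))) (frame_ne hV hfr (Or.inl (by norm_num)))
      (frame_ne hV hfr (Or.inl (by norm_num))) (frame_ne hV hfr (Or.inl (by norm_num)))
      hleaf
      (openEdgeUnion_subset_of_forall fun x y _ hxy => by
        rcases hxy with h' | h' | h'
        · rw [segment_meshPoint_eq_of_sym2_eq δ h']; exact hI _ _ _ _ hm0 hmt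
        · rw [segment_meshPoint_eq_of_sym2_eq δ h']; exact hI _ _ _ _ h0t h00
        · rw [segment_meshPoint_eq_of_sym2_eq δ (Set.mem_singleton_iff.1 h')]; exact hI _ _ _ _ h00 h10)
      hqR hqL hp't hcR h
    refine out_level2 δ Q hV hfr ht (Or.inr (Or.inl rfl)) hAê fun ⟨a, ha, b, hb, hJ⟩ =>
      key ⟨a, ha, b, hb, joinedIn_mono_config δ Q ?_ hJ⟩
    rintro x (hx | ⟨hx | hx | hx | hx, hne⟩)
    · exact Or.inl (Or.inl ⟨hx.1, fun h' => hx.2 (Or.inr h')⟩)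
    · exact Or.inl (Or.inr hx)
    · exact absurd hx hne
    · exact Or.inr (Or.inl hx)
    · exact Or.inr (Or.inr hx)

/-- Output packaging for level 3: the detour `cc → cc' → c' → c → p → q`
(`c = V (-1) 0`, `cc = V (-2) 0`, side `+1`). -/
theorem out_level3 (δ : ℝ) (Q : Quad D) {σ : BondConfig (Site 2)}
    {V : ℤ → ℤ → Site 2} {p u w : Site 2} (hV : ∀ a b, V a b = p + a • u + b • w)
    (hfr : ((u = ![1, 0] ∨ u = ![-1, 0]) ∧ (w = ![0, 1] ∨ w = ![0, -1])) ∨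
      ((u = ![0, 1] ∨ u = ![0, -1]) ∧ (w = ![1, 0] ∨ w = ![-1, 0])))
    {Adm : Sym2 (Site 2) → Prop} {e' : Sym2 (Site 2)}
    (he' : e' ∈ ({s(V (-2) 0, V (-2) 1), s(V (-2) 1, V (-1) 1), s(V (-1) 1, V (-1) 0),
      s(V (-1) 0, V 0 0), s(V 0 0, V 1 0)} : Set _))
    (hA : Adm e')
    (hnc : ¬ ∃ a ∈ Q.side 0, ∃ b ∈ Q.side 2, JoinedIn (Q.carrier ∩ openEdgeUnion δ
      (σ \ {s(V 0 0, V 1 0), s(V (-1) 0, V 0 0), s(V (-2) 0, V (-1) 0)} ∪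
        (({s(V (-2) 0, V (-2) 1), s(V (-2) 1, V (-1) 1), s(V (-1) 1, V (-1) 0),
          s(V (-1) 0, V 0 0), s(V 0 0, V 1 0)} : Set _) \ {e'}))) a b) :
    ∃ (Rm S : Set (Sym2 (Site 2))) (e' : Sym2 (Site 2)), s(V 0 0, V 1 0) ∈ Rm ∧ e' ∈ S ∧ Adm e' ∧
      (∀ r ∈ Rm ∪ S, ∃ x y, r = s(x, y) ∧ (zdGraph 2).Adj x y ∧
        ∀ i, |x i - p i| ≤ 3 ∧ |y i - p i| ≤ 3) ∧
      IsPreconnected (openEdgeUnion δ S) ∧ (∀ r ∈ Rm, ∀ x ∈ r, meshPoint δ x ∈ openEdgeUnion δ S) ∧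
      ¬ ∃ a ∈ Q.side 0, ∃ b ∈ Q.side 2,
        JoinedIn (Q.carrier ∩ openEdgeUnion δ (σ \ Rm ∪ (S \ {e'}))) a b := by
  have h1 : (zdGraph 2).Adj (V (-2) 0) (V (-2) 1) := frame_adj hV hfr (by norm_num)
  have h2 : (zdGraph 2).Adj (V (-2) 1) (V (-1) 1) := frame_adj hV hfr (by norm_num)
  have h3 : (zdGraph 2).Adj (V (-1) 1) (V (-1) 0) := frame_adj hV hfr (by norm_num)
  have h4 : (zdGraph 2).Adj (V (-1) 0) (V 0 0) := frame_adj hV hfr (by norm_num)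
  have h5 : (zdGraph 2).Adj (V 0 0) (V 1 0) := frame_adj hV hfr (by norm_num)
  refine ⟨{s(V 0 0, V 1 0), s(V (-1) 0, V 0 0), s(V (-2) 0, V (-1) 0)},
    {s(V (-2) 0, V (-2) 1), s(V (-2) 1, V (-1) 1), s(V (-1) 1, V (-1) 0), s(V (-1) 0, V 0 0),
      s(V 0 0, V 1 0)}, e', Or.inl rfl, he', hA, ?_, ?_, ?_, hnc⟩
  · rintro r ((hr | hr | hr) | hr | hr | hr | hr | hr)
    · rw [hr]; exact frame_edge_near hV hfr (by norm_num) (by norm_num) (by norm_num)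
    · rw [hr]; exact frame_edge_near hV hfr (by norm_num) (by norm_num) (by norm_num)
    · rw [Set.mem_singleton_iff.1 hr]
      exact frame_edge_near hV hfr (by norm_num) (by norm_num) (by norm_num)
    · rw [hr]; exact frame_edge_near hV hfr (by norm_num) (by norm_num) (by norm_num)
    · rw [hr]; exact frame_edge_near hV hfr (by norm_num) (by norm_num) (by norm_num)
    · rw [hr]; exact frame_edge_near hV hfr (by norm_num) (by norm_num) (by norm_num)
    · rw [hr]; exact frame_edge_near hV hfr (by norm_num) (by norm_num) (by norm_num)
    · rw [Set.mem_singleton_iff.1 hr]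
      exact frame_edge_near hV hfr (by norm_num) (by norm_num) (by norm_num)
  · refine isPreconnected_openEdgeUnion_insert δ h1 (meshPoint_mem_openEdgeUnion δ h2 (Or.inl rfl))
      (isPreconnected_openEdgeUnion_insert δ h2 (meshPoint_mem_openEdgeUnion δ h3 (Or.inl rfl))
      (isPreconnected_openEdgeUnion_insert δ h3 (meshPoint_mem_openEdgeUnion δ h4 (Or.inl rfl))
      (isPreconnected_openEdgeUnion_insert δ h4 (meshPoint_mem_openEdgeUnion δ h5 rfl) ?_)))
    rw [openEdgeUnion_singleton_eq δ h5]
    exact (convex_segment _ _).isPreconnected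
  · have hp : meshPoint δ (V 0 0) ∈ openEdgeUnion δ ({s(V (-2) 0, V (-2) 1), s(V (-2) 1, V (-1) 1),
        s(V (-1) 1, V (-1) 0), s(V (-1) 0, V 0 0), s(V 0 0, V 1 0)} : Set _) :=
      meshPoint_mem_openEdgeUnion δ h5 (Or.inr (Or.inr (Or.inr (Or.inr rfl))))
    have hc : meshPoint δ (V (-1) 0) ∈ openEdgeUnion δ ({s(V (-2) 0, V (-2) 1), s(V (-2) 1, V (-1) 1),
        s(V (-1) 1, V (-1) 0), s(V (-1) 0, V 0 0), s(V 0 0, V 1 0)} : Set _) :=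
      meshPoint_mem_openEdgeUnion δ h4 (Or.inr (Or.inr (Or.inr (Or.inl rfl))))
    rintro r (hr | hr | hr) x hx
    · rw [hr] at hx
      rcases Sym2.mem_iff.1 hx with rfl | rfl
      · exact hp
      · refine meshPoint_mem_openEdgeUnion δ h5.symm (Or.inr (Or.inr (Or.inr (Or.inr ?_))))
        rw [Sym2.eq_swap]; rfl
    · rw [hr] at hx
      rcases Sym2.mem_iff.1 hx with rfl | rfl
      exacts [hc, hp]
    · rw [Set.mem_singleton_iff.1 hr] at hx
      rcases Sym2.mem_iff.1 hx with rfl | rfl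
      exacts [meshPoint_mem_openEdgeUnion δ h1 (Or.inl rfl), hc]

end Summit.CriticalPhenomena.CardyFormulaZ2.Theorems.CardySelfRefinement

end
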